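import Literature.MathematicalPhysics.QuantumFieldTheory.Balaban1983to89.StepInhabited
import Literature.MathematicalPhysics.QuantumFieldTheory.Balaban1983to89.TreeLength
import Literature.MathematicalPhysics.QuantumFieldTheory.Balaban1983to89.B14FlowStep

/-!
# `Balaban1983to89.B16SProfile` — [Balaban1989LargeFieldII] pp. 384–385: the GEOMETRY of the iterated operation `S`
behind (1.80)–(1.81), KERNEL-CHECKED in the index model of `…B13ScaleTransfer` / `…TreeLength`, and the two profile
binders `h1`, `h2` of `Step.Budget.majorant_181` (module `…Step`, Part F1) DISCHARGED from it (cell `STEP.md` §11 row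
O-F1; `GAPS.md` row C-b02g9-1; unit b2b-balaban-b02, gen 9 — NEW leaf module, imports `…StepInhabited`, `…TreeLength`,
`…B14FlowStep` and modifies nothing)

CITATION HEADER (lean-in-tree rule 2026-08-18).  Source under audit: T. Bałaban, *Large field renormalization. II.
Localization, exponentiation, and bounds for the 𝐑 operation*, Commun. Math. Phys. **122**, 355–392 (1989)
[Balaban1989LargeFieldII] (cell paper B16; held `paper:balaban1989-cmp122-large-field-ii`, journal page = PDF page
+ 354; the passage below was read on the x2 render `b2b-balaban-ref1/pages/1989-cmp122-large-field-II/…-p030-x2.png`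
(p. 384) and `…-p031-x2.png` (p. 385)).  Flow inputs: T. Bałaban, *Convergent renormalization expansions for lattice
gauge theories*, Commun. Math. Phys. **119**, 243–285 (1988) [Balaban1988Convergent] (= [III], cell paper B14),
(2.5) p. 255, (2.7) p. 255, (2.9) p. 256 — used ONLY through the typed displays `B14.IsRj`, `B14.FlowIneq27` of module
`…B14` and the one-pair lemma shape of `…B14FlowStep.ineq29a_pair`.  Cube layers `X~ⁿ` in the sup-metric sense:
[Balaban1987RG1] (= [I], cell paper B12) p. 257, prose definition (typed as `B13ScaleTransfer.collar`).  The papers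
are manuscripts UNDER ADJUDICATION by the audit cell `pub-balaban`: NOTHING printed in them is asserted here; every
`theorem` below is finite combinatorics on `ℤᵈ` and real arithmetic, proved without `sorry` and without new axioms,
over the EXISTING definitions `B13ScaleTransfer.{Pt, block, collar, coarse, closureIdx, FaceConnected}`,
`TreeLength.treeLen`, `Step.Budget.{Consts, Consts.cost, RStepLe}`, `Step.InInterval`, `B14.{IsRj, FlowIneq27}`.

THE PRINTED TEXT.  B16 p. 384 [PDF 30]: *"To formulate it, we introduce an operation S, naturally connected with our
procedure. If Z is a union of MR_j-cubes of the lattice T_ξ, ξ = L^{−j}, then we take the cover Z′ of Z by a smallest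
union of LMR_{j+1}-cubes, and we add ten layers of such cubes. We denote the obtained domain by S(Z), i.e.,
S(Z) = Z′^{~10}. … The operation S may be iterated. … More precisely this means that
(1.80)  κ_j(Z) ≥ Σ_{n=j+1}^{j+K} O(1)M^dR_n^{d+1}d′_n(S^{n−j}(Z)).
We prove this statement by an induction with respect to j. At first we estimate the sum on the right-hand side above.
Consider the domain S^{n−j}(Z). The domain Z is a union of MR_j-cubes □, Z = ⋃_{□⊂Z} □, and by the definition of the
operation S we have S^{n−j}(Z) = ⋃_{□⊂Z} S^{n−j}(□). It is easy to see that S^{n−j}(□) is a cube, which is a union of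
L^d_{n−j}MR_n-cubes, where  L_{n−j} ≤ 42 (1 − L^{−(n−j)})/(1 − L^{−1}) < 63.  The MR_n-cube in the center of S^{n−j}(□)
contains □. Denote by Z^{(n−j)} the cover of Z by MR_n-cubes in the corresponding scale (i.e., by L^{n−j}MR_n-cubes in
L^{−j}-scale). Thus S^{n−j}(Z) ⊂ ⋃_{□₀⊂Z^{(n−j)}} □₀^{~31}, and this implies
d′_n(S^{n−j}(Z)) ≤ (63)^d(MR_n)^{−d}|Z^{(n−j)}| ≤ (63)^d 3·2^{d−1} d′_n(Z^{(n−j)})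
if the linear size on the right-hand side is different from 0, or d′_n(S^{n−j}(Z)) ≤ (64)^d if it is equal to 0. From
the scaling property (6.31) [I] we obtain  d′_n(Z^{(n−j)}) ≤ L^{−½(n−j)}d′_j(Z) ≤ 2^{−(n−j)}d′_j(Z)"*  — p. 385 [PDF 31]:
*"for n − j > 1. The square root appears here, because for some steps we do not gain the scaling factor L^{−1} (then
R_{m+1} = LR_m). Consider now the sum in (1.80). Let n₀ be the last index n such that d′_n(Z^{(n−j)}) > 0. Then
S^{n₀+1−j}(Z) is contained in a cube of the size 64MR_{n₀+1}, hence it satisfies the condition (i), and doing at most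
R_j further steps we obtain a domain satisfying both conditions (i), (ii). Thus K ≤ n₀ − j + R_j, and we have (1.81)
Σ_{n=j+1}^{j+K} O(1)M^dR_n^{d+1}d′_n(S^{n−j}(Z)) ≤ Σ_{n=j+1}^{n₀} O(1)M^dR_n^{d+1}3(126)^d2^{−(n−j)}d′_j(Z)
+ Σ_{n=n₀+1}^{n₀+R_j} O(1)M^d dR_n^{d+1}(64)^d ≤ … ≤ O(1)(64)^dM^dL^{d+1}R_j^{d+2}(d′_j(Z) + 1)."*  [III] (2.9) p. 256
[PDF 14]: *"R_n ≤ L R_m , R_m ≤ L(1 + g_n² β′(n−m))^{β₀} R_n ≤ (L+1)(n−m)^{β₀} R_n"* (pairs *"where n > m"*, p. 255);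
(2.5) p. 255: *"R_j is the smallest number of the form L^r such, that R_j ≥ (log g_j⁻²)^r"*; (2.7) p. 255, second
member: *"(log g_m⁻²)^p ≤ (1 + g_n² β′(n−m))^{β₀} (log g_n⁻²)^p"*.

READING (declared, not printed — the index model of `…B13ScaleTransfer`, [Dimock2013] §3 Lemma 10 shape).  At flow
step `n ≥ j` the partition of space into `MR_n`-cubes of `T_{L^{−n}}` is indexed by `Pt d = ℤᵈ` (one index point per
cube); consecutive partitions are NESTED and the ratio of consecutive cube sides is the positive integer
`q_n := LMR_{n+1}·L^{−n} / (MR_n·L^{−n}) = L·R_{n+1}/R_n` — a power of `L`, since the `R`'s are ((2.5)); passing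
to the next partition is the index map `coarse q_n = ⌊·/q_n⌋` coordinatewise, so *"the cover Z′ of Z by a smallest
union of LMR_{j+1}-cubes"* is `closureIdx q Z`, *"ten layers of such cubes"* (sup-metric layers, [I] p. 257) is
`collar^[10]`, and `S = Sop q := collar^[10] ∘ closureIdx q`; `S^{i}(Z) = Siter q i Z` iterates it along the ratio
sequence, and *"Z^{(n−j)}, the cover of Z by MR_n-cubes"* is `closureIdx (Q_{n−j}) Z` with `Q_i = q_j ⋯ q_{j+i−1}`
(`Qprod`).  `d′_n` = the linear size in units of `MR_n`-cubes = `TreeLength.treeLen` of the index set ([I] p. 257,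
[II] (2.30)).  With `R_n = L^{σ_n}` ((2.5)): `q_n = L^{e_n}`, `e_n = σ_{n+1} + 1 − σ_n` (`qexp`, `ratio`); a step
with `e_n = 0` (`q_n = 1`, the partition does not change, ten layers are added at full size) is a step where *"we do
not gain the scaling factor L^{−1}"*.  The flow control actually USED is the typed predicate `DropCtl σ m`: for
`i < k ≤ m`, `2σ_i ≤ 2σ_k + max(k − i, 2)` — the net number of no-gain steps in a window of `ℓ` steps is `≤ 1` for
`ℓ ≤ 3` and `≤ ℓ/2` for `ℓ ≥ 2`, which is precisely what *"d′_n(Z^{(n−j)}) ≤ L^{−½(n−j)}d′_j(Z) … for n − j > 1"*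
requires (Part 5), and which Part 8 DERIVES from (2.7)'s second member, the minimality in (2.5) and the located
smallness `(1 + g_n²β′(n−m))^{β₀} ≤ L^{⌊max(n−m,2)/2⌋}` (itself a theorem for `β₀ ≤ ½`, `g_n²β′ ≤ 1`, `L ≥ 2`:
`theta_le_pow`).  The FIRST member of (2.9) (`Step.Budget.RStepLe`, = `B14FlowStep.FlowIneq29`'s first conjunct)
enters only through `Step.Budget.majorant_181_of_rStepLe` (the factor `L^{d+1}R_j^{d+1}`).

WHAT IS PROVED (unconditionally, for every dimension `d`).
* Part 1–3 (boxes and one step): `box c r` = the cube of cubes `□^{~r}` of index radius `r` (`card_box`: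
  `(2r+1)^d`); `collar^[n] (box c r) ⊆ box c (r+n)`; ONE COARSENING SENDS BOXES TO BOXES: `closureIdx q (box c r) ⊆
  box (coarse q c) (⌊r/q⌋ + 1)` (`closureIdx_box_subset`, `q ≥ 1`) and `closureIdx 1 = id`; hence `Sop q (box c r) ⊆
  box (coarse q c) (⌊r/q⌋ + 11)` and `Sop 1 (box c r) ⊆ box c (r + 10)`; `S` distributes over unions
  (`Sop_biUnion`, `Siter_eq_biUnion` — the printed *"S^{n−j}(Z) = ⋃_{□⊂Z} S^{n−j}(□)"*), preserves face-connectedness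
  and non-emptiness; `coarse b ∘ coarse a = coarse (ab)` (nested partitions compose).
* Part 4 (THE RADIUS 31): under `DropCtl σ m` and `3 ≤ L`, for every index cube `z` and every `i ≤ m`,
  `Siter (ratio L σ) i {z} ⊆ box (coarse (Q_i) z) 31` with the sharper invariant `RadInv` (radius ≤ 21, except ≤ 31
  right after a no-gain step; two consecutive no-gain steps are excluded by `DropCtl` at lag 2, and one gaining step
  `q ≥ L ≥ 3` brings `31` back to `⌊31/3⌋ + 11 = 21`) — `Siter_singleton_subset_box`; hence the printed
  *"S^{n−j}(Z) ⊂ ⋃_{□₀⊂Z^{(n−j)}} □₀^{~31}"* (`Siter_subset_biUnion_box`) and `|S^{i}(Z)| ≤ 63^d·|Z^{(i)}|`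
  (`card_Siter_le`), for EVERY `L ≥ 3` (cf. `Step.Budget.L_iter_lt_63`: the printed `< 63` needs `L ≥ 3`); and the
  scaling bookkeeping `Q_i·L^{σ_0} = L^{i+σ_i}` (`Qprod_ratio_mul_pow`), `2^i ≤ Q_i` for `i ≥ 2`, `L ≥ 4`
  (`two_pow_le_Qprod` — the printed `L^{−½(n−j)} ≤ 2^{−(n−j)}`, cf. `Step.Budget.sqrt_scaling_le_half_pow`: `L ≥ 4`).
* Part 5 (THE PROFILE): with `t_i := treeLen (closureIdx Q_i Z)` (= `d′_{j+i}(Z^{(i)})`) and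
  `s_i := treeLen (Siter … i Z)` (= `d′_{j+i}(S^{i}(Z))`), for non-empty face-connected `Z`: `t` is non-increasing
  (`treeLen_closureIdx_antitone`, from `TreeLength.mul_treeLen_closureIdx_le`); `2^i·t_i ≤ t_0` (`i ≥ 2`, `L ≥ 4`);
  `s_i ≤ 63^d·2^d(4t_i + 1) − 1` (`treeLen_Siter_le`, from `TreeLength.treeLen_le_card_sub_one`, `card_Siter_le` and
  the REPAIRED lower (2.30) `TreeLength.card_le_treeLen`); whence THE TWO BINDERS OF F1: `s_i ≤ 10·126^d·(1/2)^i·t_0`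
  when `t_i ≥ 1`, `1 ≤ i` (`profile_h1`) and `s_i ≤ 5·126^d` when `t_i < 1` (`profile_h2`).
* Part 6: the last index `n₀` (`exists_threshold`: `t_i ≥ 1` for `1 ≤ i ≤ i₀`, `t_i < 1` for `i₀ < i ≤ m`).
* Part 7: `majorant_181_of_flow` = `Step.Budget.majorant_181_of_rStepLe` WITH `h1`, `h2` SUPPLIED: for sizes
  `R_n = L^{σ_n}` (`n ≤ K`) obeying (2.9a) (`RStepLe`) and `DropCtl`, `L ≥ 4`, non-empty face-connected `Z`, `j ≤ n₀`,
  `n₀ + r ≤ K` and the threshold property of `n₀`: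
  `Σ_{n=j+1}^{n₀+r} cost_n(d′_n(S^{n−j}Z)) ≤ C·M^{d_b}·(L^{d_b+1}R_j^{d_b+1})·(10·126^d·d′_j(Z) + 5·126^d·r)` — the passage
  from the second to the third expression of (1.81) with EXPLICIT constants (`d_b = b.d` the dimension parameter of the
  cost constants, `d` the dimension of the index lattice; equal in the application, kept apart here).
* Part 8 (the flow inputs from [III]): `exists_exponents` ((2.5) ⇒ `R_n = L^{σ_n}` with the minimality clause);
  `exp_drop_le` (ONE PAIR: (2.7b) with a factor `Θ ≤ L^a` and (2.5) give `σ_m ≤ σ_n + a` — the rounding mechanism of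
  `B14FlowStep.ineq29a_pair`, exponent form); `dropCtl_of_27b`; `theta_le_pow` (the located smallness is inhabited for
  every lag); `majorant_181_of_B14` (END TO END: from `Step.InInterval γ K g`, `γ ≤ 1`, (2.5) on the horizon, (2.9a),
  (2.7), the Θ-smallness, `L ≥ 4` and a non-empty face-connected `Z`: exponents `σ`, the index `n₀ ∈ [j, K]` with its
  threshold property, and (1.81)'s middle inequality for every `r ≤ K − n₀`).
WHAT IS *NOT* ASSERTED: the stopping rule *"K ≤ n₀ − j + R_j"* (conditions (i), (ii) of p. 383 are reader-level; `r`
stays a parameter, as in F1); that the partitions of the actual lattices `T_{L^{−n}}` are nested and cube sides are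
`L`-powers (the READING above; (2.5) makes `R_n` an `L`-power, `M` is one by [I]); anything about fields, densities,
`κ_j`, or the induction (1.82)–(1.89) (module `…Step`, Part F); the printed constants `3·2^{d−1}` / `(64)^d` (they rest
on the lower half of [II] (2.30), recorded FALSE as printed for small sizes in `…TreeLength`/cell `GAPS.md` G-B13-07 —
the repaired `card_le_treeLen` gives `10·126^d` / `5·126^d`, immaterial inside the `O(1)` of (1.81)); *"(6.31) [I]"*
(UNRESOLVABLE: [I] = [Balaban1987RG1] has §§0–5, last display (5.44); the coarsening inequality used instead is the
theorem `TreeLength.mul_treeLen_closureIdx_le`, [Dimock2013] Lemma 10 shape — cell `GAPS.md` C-b02g9-1 (b));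
the print's parenthesis *"(then R_{m+1} = LR_m)"* (in the index model the no-gain step is `q_m = LR_{m+1}/R_m = 1`,
i.e. `R_{m+1} = R_m/L` — recorded as cell `DIVERGENCE.md` D-b02g9.1, not adjudicated); the threshold is typed
`d′ ≥ 1` / `d′ < 1` where the print has `d′ > 0` / `d′ = 0` (the same dichotomy for trees on the integer lattice; not
needed and not proved).  Value = kernel-checked reading of one printed geometric estimate + discharged binders of an
existing typed skeleton + located gaps, NOT summit progress.
-/

namespace Literature.MathematicalPhysics.QuantumFieldTheory.Balaban1983to89.B16SProfile

open Literature.MathematicalPhysics.QuantumFieldTheory.Balaban1983to89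
open Literature.MathematicalPhysics.QuantumFieldTheory.Balaban1983to89.B13ScaleTransfer
open Literature.MathematicalPhysics.QuantumFieldTheory.Balaban1983to89.TreeLength

noncomputable section

variable {d : ℕ}

/-! ## Part 1. The cube of cubes `□^{~r}` of index radius `r`, and sup-metric layers -/

/-- The cube of cubes of index radius `r` about the index cube `c`: all `y ∈ ℤᵈ` with `|y_i − c_i| ≤ r` for every
coordinate — the printed `□^{~r}` (`r` sup-metric layers of cubes around `□`, [I] p. 257), in the index model of
`…B13ScaleTransfer` (`block c = box c 1`). [cite: Balaban1987RG1, p.257 (cube layers □̃ⁿ)] -/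
def box (c : Pt d) (r : ℕ) : Finset (Pt d) := Fintype.piFinset fun i => Finset.Icc (c i - r) (c i + r)

/-- Membership in a box, coordinatewise. [folklore] -/
theorem mem_box {c y : Pt d} {r : ℕ} : y ∈ box c r ↔ ∀ i, c i - r ≤ y i ∧ y i ≤ c i + r := by
  simp [box, Fintype.mem_piFinset, Finset.mem_Icc]

/-- The centre belongs to its box. [folklore] -/
theorem mem_box_self (c : Pt d) (r : ℕ) : c ∈ box c r := by
  have hr : (0 : ℤ) ≤ r := by positivity
  exact mem_box.mpr fun i => ⟨by linarith, by linarith⟩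

/-- Boxes grow with the radius. [folklore] -/
theorem box_mono (c : Pt d) {r r' : ℕ} (h : r ≤ r') : box c r ⊆ box c r' := by
  intro y hy
  rw [mem_box] at hy ⊢
  have hc : (r : ℤ) ≤ r' := by exact_mod_cast h
  intro i
  obtain ⟨h1, h2⟩ := hy i
  exact ⟨by linarith, by linarith⟩

/-- `|□^{~r}| = (2r+1)^d` cubes — for `r = 31` the printed `(63)^d`. [cite: Balaban1989LargeFieldII, p.384 (display after (1.80))] -/
theorem card_box (c : Pt d) (r : ℕ) : (box c r).card = (2 * r + 1) ^ d := by
  rw [box, Fintype.card_piFinset]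
  have h : ∀ i : Fin d, (Finset.Icc (c i - r) (c i + r)).card = 2 * r + 1 := by
    intro i
    rw [Int.card_Icc]
    have : c i + r + 1 - (c i - r) = ((2 * r + 1 : ℕ) : ℤ) := by push_cast; ring
    rw [this]
    exact Int.toNat_natCast _
  simp [h, Finset.prod_const, Finset.card_univ, Fintype.card_fin]

/-- The `3^d`-block of `…B13ScaleTransfer` is the box of radius 1. [folklore] -/
theorem block_eq_box (c : Pt d) : B13ScaleTransfer.block c = box c 1 := by
  ext y
  rw [B13ScaleTransfer.mem_block, mem_box]
  push_cast
  exact Iff.rfl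

/-- Membership in one sup-metric layer (`collar X = ⋃_{x∈X} block x`). [folklore] -/
theorem mem_collar {X : Finset (Pt d)} {y : Pt d} : y ∈ collar X ↔ ∃ x ∈ X, y ∈ B13ScaleTransfer.block x :=
  Finset.mem_biUnion

-- Monotonicity of `collar` and of `closureIdx q` is landed as `B13Geometry236.collar_mono` /
-- `B13Geometry236.closureIdx_mono` (module `…B13Geometry236`, not imported here to keep the import cone small); below the
-- one-line Mathlib terms `Finset.biUnion_subset_biUnion_of_subset_left` / `Finset.image_subset_image` are used in place.

/-- One layer around a box of radius `r` lies in the box of radius `r + 1`. [folklore] -/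
theorem collar_box_subset (c : Pt d) (r : ℕ) : collar (box c r) ⊆ box c (r + 1) := by
  intro y hy
  obtain ⟨x, hx, hyx⟩ := mem_collar.mp hy
  rw [mem_box] at hx ⊢
  rw [B13ScaleTransfer.mem_block] at hyx
  intro i
  obtain ⟨h1, h2⟩ := hx i
  obtain ⟨h3, h4⟩ := hyx i
  push_cast
  exact ⟨by linarith, by linarith⟩

/-- `n` layers are monotone. [folklore] -/
theorem iterate_collar_mono (n : ℕ) {X Y : Finset (Pt d)} (h : X ⊆ Y) : collar^[n] X ⊆ collar^[n] Y := by
  induction n with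
  | zero => simpa using h
  | succ n ih =>
    rw [Function.iterate_succ_apply', Function.iterate_succ_apply']
    exact Finset.biUnion_subset_biUnion_of_subset_left _ ih

/-- `n` layers around a box of radius `r` lie in the box of radius `r + n` (`(□^{~r})^{~n} ⊆ □^{~(r+n)}`). [folklore] -/
theorem iterate_collar_box_subset (c : Pt d) (r n : ℕ) : collar^[n] (box c r) ⊆ box c (r + n) := by
  induction n with
  | zero => simp
  | succ n ih =>
    rw [Function.iterate_succ_apply']
    exact (Finset.biUnion_subset_biUnion_of_subset_left _ ih).trans (collar_box_subset c (r + n))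

/-- A set lies inside its `n`-layer enlargement. [folklore] -/
theorem subset_iterate_collar (n : ℕ) (X : Finset (Pt d)) : X ⊆ collar^[n] X := by
  induction n with
  | zero => simp
  | succ n ih =>
    rw [Function.iterate_succ_apply']
    exact ih.trans (subset_collar _)

/-- Adding layers preserves face-connectedness (iterate of `B13ScaleTransfer.faceConnected_collar`). [folklore] -/
theorem faceConnected_iterate_collar (n : ℕ) {X : Finset (Pt d)} (hX : FaceConnected X) :
    FaceConnected (collar^[n] X) := by
  induction n with
  | zero => simpa using hX
  | succ n ih =>
    rw [Function.iterate_succ_apply']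
    exact faceConnected_collar ih

/-- Adding layers distributes over unions. [folklore] -/
theorem iterate_collar_biUnion {α : Type*} (n : ℕ) (s : Finset α) (t : α → Finset (Pt d)) :
    collar^[n] (s.biUnion t) = s.biUnion fun a => collar^[n] (t a) := by
  induction n with
  | zero => simp
  | succ n ih =>
    simp only [Function.iterate_succ_apply']
    rw [ih, collar, Finset.biUnion_biUnion]
    rfl

/-! ## Part 2. Covering by the cubes of a coarser nested partition: boxes go to boxes -/

/-- Ratio `1`: the partition does not change (`⌊x/1⌋ = x`). [folklore] -/
theorem coarse_one (x : Pt d) : coarse 1 x = x := by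
  funext i
  simp [coarse]

/-- Ratio `1`: the cover of `X` by the cubes of the same partition is `X`. [folklore] -/
theorem closureIdx_one (X : Finset (Pt d)) : closureIdx 1 X = X := by
  have h : (coarse 1 : Pt d → Pt d) = fun x => x := funext coarse_one
  rw [closureIdx, h, Finset.image_id']

/-- Nested partitions compose: coarsening by `a` then by `b` is coarsening by `ab` (`⌊⌊x/a⌋/b⌋ = ⌊x/(ab)⌋`). [folklore] -/
theorem coarse_coarse (a b : ℕ) (x : Pt d) : coarse b (coarse a x) = coarse (a * b) x := by
  funext i
  simp only [coarse]
  push_cast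
  exact Int.ediv_ediv_of_nonneg (by positivity)

/-- Covers compose along nested partitions. [folklore] -/
theorem closureIdx_closureIdx (a b : ℕ) (X : Finset (Pt d)) :
    closureIdx b (closureIdx a X) = closureIdx (a * b) X := by
  rw [closureIdx, closureIdx, closureIdx, Finset.image_image]
  congr 1
  funext x
  exact coarse_coarse a b x

/-- Covering distributes over unions. [folklore] -/
theorem closureIdx_biUnion {α : Type*} (q : ℕ) (s : Finset α) (t : α → Finset (Pt d)) :
    closureIdx q (s.biUnion t) = s.biUnion fun a => closureIdx q (t a) := by
  unfold closureIdx
  exact Finset.biUnion_image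

/-- The arithmetic of one coarsening step on one coordinate: if `|y − c| ≤ r` then `⌊y/q⌋` lies within `⌊r/q⌋ + 1`
of `⌊c/q⌋` (`q ≥ 1`; write `c = q⌊c/q⌋ + c mod q`, `r = q⌊r/q⌋ + r mod q`). [folklore] -/
theorem ediv_near {q : ℕ} (hq : 0 < q) {c y : ℤ} {r : ℕ} (h1 : c - r ≤ y) (h2 : y ≤ c + r) :
    c / (q : ℤ) - ((r / q : ℕ) : ℤ) - 1 ≤ y / (q : ℤ) ∧ y / (q : ℤ) ≤ c / (q : ℤ) + ((r / q : ℕ) : ℤ) + 1 := by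
  have hq' : (0 : ℤ) < q := by exact_mod_cast hq
  have hc : (q : ℤ) * (c / (q : ℤ)) + c % (q : ℤ) = c := Int.mul_ediv_add_emod c q
  have hm0 : 0 ≤ c % (q : ℤ) := Int.emod_nonneg c hq'.ne'
  have hm1 : c % (q : ℤ) < q := Int.emod_lt_of_pos c hq'
  have hr1 : ((r / q : ℕ) : ℤ) * (q : ℤ) ≤ r := by exact_mod_cast Nat.div_mul_le_self r q
  have hr2 : (r : ℤ) < ((r / q : ℕ) : ℤ) * (q : ℤ) + q := by exact_mod_cast Nat.lt_div_mul_add hq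
  set u : ℤ := c / (q : ℤ) with hu
  set k : ℤ := ((r / q : ℕ) : ℤ) with hk
  constructor
  · rw [Int.le_ediv_iff_mul_le hq']
    have e : (u - k - 1) * (q : ℤ) = (q : ℤ) * u - k * (q : ℤ) - q := by ring
    rw [e]
    linarith
  · have hlt : y / (q : ℤ) < (u + k + 1) + 1 := by
      rw [Int.ediv_lt_iff_lt_mul hq']
      have e : (u + k + 1 + 1) * (q : ℤ) = (q : ℤ) * u + k * (q : ℤ) + q + q := by ring
      rw [e]
      linarith
    exact Int.lt_add_one_iff.mp hlt

/-- ONE COARSENING SENDS BOXES TO BOXES: the cover of `□^{~r}` (index box of radius `r` about `c`) by the cubes of the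
`q`-times coarser nested partition lies in the box of radius `⌊r/q⌋ + 1` about the coarse cube containing `c` — the
mechanism behind *"It is easy to see that S^{n−j}(□) is a cube … The MR_n-cube in the center of S^{n−j}(□) contains □"*.
[cite: Balaban1989LargeFieldII, p.384 (display after (1.80))] -/
theorem closureIdx_box_subset {q : ℕ} (hq : 0 < q) (c : Pt d) (r : ℕ) :
    closureIdx q (box c r) ⊆ box (coarse q c) (r / q + 1) := by
  intro b hb
  obtain ⟨y, hy, rfl⟩ := Finset.mem_image.mp hb
  rw [mem_box] at hy ⊢
  intro i
  obtain ⟨h1, h2⟩ := hy i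
  obtain ⟨h3, h4⟩ := ediv_near hq h1 h2
  simp only [coarse]
  push_cast at h3 h4 ⊢
  exact ⟨by linarith, by linarith⟩

/-! ## Part 3. The operation `S` of p. 384 in the index model, and its iterates -/

/-- `S(Z) = Z′^{~10}`: the cover of `Z` by the cubes of the `q`-times coarser nested partition, plus ten sup-metric
layers of such cubes (`q` = the ratio of consecutive cube sides, `LR_{j+1}/R_j` in the application). [cite: Balaban1989LargeFieldII, p.384 (definition of S)] -/
def Sop (q : ℕ) (X : Finset (Pt d)) : Finset (Pt d) := collar^[10] (closureIdx q X)

/-- `S` is monotone. [folklore] -/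
theorem Sop_mono (q : ℕ) {X Y : Finset (Pt d)} (h : X ⊆ Y) : Sop q X ⊆ Sop q Y :=
  iterate_collar_mono 10 (Finset.image_subset_image h)

/-- `S` of a box of radius `r` lies in the box of radius `⌊r/q⌋ + 11` about the coarse centre (`q ≥ 1`). [cite: Balaban1989LargeFieldII, p.384 (display after (1.80))] -/
theorem Sop_box_subset {q : ℕ} (hq : 0 < q) (c : Pt d) (r : ℕ) :
    Sop q (box c r) ⊆ box (coarse q c) (r / q + 11) :=
  (iterate_collar_mono 10 (closureIdx_box_subset hq c r)).trans (iterate_collar_box_subset _ _ 10)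

/-- A NO-GAIN step (`q = 1`, the partition does not change): `S(□^{~r}) ⊆ □^{~(r+10)}` exactly. [cite: Balaban1989LargeFieldII, p.385 ("for some steps we do not gain the scaling factor")] -/
theorem Sop_one_box_subset (c : Pt d) (r : ℕ) : Sop 1 (box c r) ⊆ box c (r + 10) := by
  unfold Sop
  rw [closureIdx_one]
  exact iterate_collar_box_subset c r 10

/-- `S` preserves face-connectedness (`q ≥ 1`). [folklore] -/
theorem faceConnected_Sop {q : ℕ} (hq : 0 < q) {X : Finset (Pt d)} (hX : FaceConnected X) :
    FaceConnected (Sop q X) :=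
  faceConnected_iterate_collar 10 (faceConnected_closureIdx hq hX)

/-- `S` of a non-empty set is non-empty. [folklore] -/
theorem Sop_nonempty (q : ℕ) {X : Finset (Pt d)} (hX : X.Nonempty) : (Sop q X).Nonempty :=
  (closureIdx_nonempty hX).mono (subset_iterate_collar 10 _)

/-- `S` distributes over unions — *"by the definition of the operation S we have S^{n−j}(Z) = ⋃_{□⊂Z} S^{n−j}(□)"*.
[cite: Balaban1989LargeFieldII, p.384 (display after (1.80))] -/
theorem Sop_biUnion {α : Type*} (q : ℕ) (s : Finset α) (t : α → Finset (Pt d)) :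
    Sop q (s.biUnion t) = s.biUnion fun a => Sop q (t a) := by
  unfold Sop
  rw [closureIdx_biUnion, iterate_collar_biUnion]

/-- *"The operation S may be iterated"*: `S^{i}` along a sequence of ratios `q₀, q₁, …` (the partitions at the successive
steps). [cite: Balaban1989LargeFieldII, p.384 (definition of S)] -/
def Siter (q : ℕ → ℕ) : ℕ → Finset (Pt d) → Finset (Pt d)
  | 0 => fun X => X
  | i + 1 => fun X => Sop (q i) (Siter q i X)

/-- `S⁰ = id`. [folklore] -/
@[simp] theorem Siter_zero (q : ℕ → ℕ) (X : Finset (Pt d)) : Siter q 0 X = X := rfl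

/-- `S^{i+1} = S_{q_i} ∘ S^{i}`. [folklore] -/
@[simp] theorem Siter_succ (q : ℕ → ℕ) (i : ℕ) (X : Finset (Pt d)) :
    Siter q (i + 1) X = Sop (q i) (Siter q i X) := rfl

/-- The accumulated ratio `Q_i = q₀⋯q_{i−1}`: the side of the step-`(j+i)` cubes in units of step-`j` cubes (the
printed `L^{n−j}MR_n`-cubes *"in L^{−j}-scale"*, up to the `R`-ratio). [cite: Balaban1989LargeFieldII, p.384 (definition of Z^{(n−j)})] -/
def Qprod (q : ℕ → ℕ) (i : ℕ) : ℕ := ∏ l ∈ Finset.range i, q l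

/-- `Q_0 = 1`. [folklore] -/
@[simp] theorem Qprod_zero (q : ℕ → ℕ) : Qprod q 0 = 1 := by simp [Qprod]

/-- `Q_{i+1} = Q_i q_i`. [folklore] -/
theorem Qprod_succ (q : ℕ → ℕ) (i : ℕ) : Qprod q (i + 1) = Qprod q i * q i := by
  simp [Qprod, Finset.prod_range_succ]

/-- `Q_i ≥ 1` for positive ratios. [folklore] -/
theorem Qprod_pos {q : ℕ → ℕ} (hq : ∀ l, 0 < q l) (i : ℕ) : 0 < Qprod q i :=
  Finset.prod_pos fun l _ => hq l

/-- The iterates distribute over unions. [cite: Balaban1989LargeFieldII, p.384 (display after (1.80))] -/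
theorem Siter_biUnion {α : Type*} (q : ℕ → ℕ) (i : ℕ) (s : Finset α) (t : α → Finset (Pt d)) :
    Siter q i (s.biUnion t) = s.biUnion fun a => Siter q i (t a) := by
  induction i with
  | zero => rfl
  | succ i ih => rw [Siter_succ, ih, Sop_biUnion]; rfl

/-- *"S^{n−j}(Z) = ⋃_{□⊂Z} S^{n−j}(□)"* verbatim: the iterate of `Z` is the union of the iterates of its cubes.
[cite: Balaban1989LargeFieldII, p.384 (display after (1.80))] -/
theorem Siter_eq_biUnion (q : ℕ → ℕ) (i : ℕ) (Z : Finset (Pt d)) :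
    Siter q i Z = Z.biUnion fun z => Siter q i {z} := by
  conv_lhs => rw [← Finset.biUnion_singleton_eq_self (s := Z)]
  exact Siter_biUnion q i Z _

/-- The iterates of a face-connected set are face-connected (positive ratios). [folklore] -/
theorem faceConnected_Siter {q : ℕ → ℕ} (hq : ∀ l, 0 < q l) {Z : Finset (Pt d)} (hZ : FaceConnected Z) (i : ℕ) :
    FaceConnected (Siter q i Z) := by
  induction i with
  | zero => exact hZ
  | succ i ih => exact faceConnected_Sop (hq i) ih

/-- The iterates of a non-empty set are non-empty. [folklore] -/
theorem Siter_nonempty (q : ℕ → ℕ) {Z : Finset (Pt d)} (hZ : Z.Nonempty) (i : ℕ) : (Siter q i Z).Nonempty := by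
  induction i with
  | zero => exact hZ
  | succ i ih => exact Sop_nonempty _ ih

/-- `Z^{(i+1)}` is the cover of `Z^{(i)}` by the next partition (nestedness). [folklore] -/
theorem closureIdx_Qprod_succ (q : ℕ → ℕ) (i : ℕ) (Z : Finset (Pt d)) :
    closureIdx (Qprod q (i + 1)) Z = closureIdx (q i) (closureIdx (Qprod q i) Z) := by
  rw [Qprod_succ, closureIdx_closureIdx]

/-! ## Part 4. The ratios of the flow (`R_n = L^{σ_n}`), the two-sided drop control, and THE RADIUS 31 -/

/-- The exponent of the ratio of consecutive cube sides: `q_i = LR_{i+1}/R_i = L^{σ_{i+1}+1−σ_i}` for `R = L^σ`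
(truncated subtraction; exact under `DropCtl`, which gives `σ_i ≤ σ_{i+1} + 1`). [cite: Balaban1988Convergent, (2.5) p.255] -/
def qexp (σ : ℕ → ℕ) (i : ℕ) : ℕ := σ (i + 1) + 1 - σ i

/-- The ratio sequence of the flow: `q_i = L^{e_i}`. [cite: Balaban1988Convergent, (2.5) p.255] -/
def ratio (L : ℕ) (σ : ℕ → ℕ) (i : ℕ) : ℕ := L ^ qexp σ i

/-- Ratios are positive (`L ≥ 1`). [folklore] -/
theorem ratio_pos {L : ℕ} (hL : 0 < L) (σ : ℕ → ℕ) (i : ℕ) : 0 < ratio L σ i := Nat.pow_pos hL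

/-- THE TWO-SIDED DROP CONTROL of the size exponents on the horizon `[0, m]`: for `i < k ≤ m`,
`2σ_i ≤ 2σ_k + max(k − i, 2)` — at most ONE net no-gain step in any window of `≤ 3` steps and at most `ℓ/2` in a window
of `ℓ ≥ 2` steps.  This is the typed content of (2.9)'s second/third member as USED on p. 385 (*"d′_n(Z^{(n−j)}) ≤
L^{−½(n−j)} d′_j(Z) … for n − j > 1. The square root appears here, because for some steps we do not gain the scaling
factor"*); it is DERIVED from (2.7), (2.5) and a located smallness in Part 8 (`dropCtl_of_27b`). [cite: Balaban1989LargeFieldII, p.385 lines 1–3] -/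
def DropCtl (σ : ℕ → ℕ) (m : ℕ) : Prop := ∀ i k, i < k → k ≤ m → 2 * σ i ≤ 2 * σ k + max (k - i) 2

/-- Drop control restricts to shorter horizons. [folklore] -/
theorem DropCtl.mono {σ : ℕ → ℕ} {m m' : ℕ} (h : DropCtl σ m) (hm : m' ≤ m) : DropCtl σ m' :=
  fun i k hik hk => h i k hik (le_trans hk hm)

/-- Lag 1: one step drops the exponent by at most one (`R_i ≤ L R_{i+1}`). [cite: Balaban1988Convergent, (2.9) p.256] -/
theorem DropCtl.lag_one {σ : ℕ → ℕ} {m i : ℕ} (h : DropCtl σ m) (hi : i + 1 ≤ m) : σ i ≤ σ (i + 1) + 1 := by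
  have h1 := h i (i + 1) (by omega) hi
  have e : max (i + 1 - i) 2 = 2 := by
    rw [show i + 1 - i = 1 by omega]
    norm_num
  rw [e] at h1
  omega

/-- Lag 2: two steps drop the exponent by at most one in total — NO TWO CONSECUTIVE NO-GAIN STEPS. [cite: Balaban1988Convergent, (2.9) p.256] -/
theorem DropCtl.lag_two {σ : ℕ → ℕ} {m i : ℕ} (h : DropCtl σ m) (hi : i + 2 ≤ m) : σ i ≤ σ (i + 2) + 1 := by
  have h1 := h i (i + 2) (by omega) hi
  have e : max (i + 2 - i) 2 = 2 := by
    rw [show i + 2 - i = 2 by omega, max_self]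
  rw [e] at h1
  omega

/-- From the start of the horizon: `2(σ_0 − σ_k) ≤ k` for `2 ≤ k ≤ m` (the printed square root). [cite: Balaban1989LargeFieldII, p.385 lines 1–3] -/
theorem DropCtl.from_zero {σ : ℕ → ℕ} {m k : ℕ} (h : DropCtl σ m) (hk2 : 2 ≤ k) (hk : k ≤ m) :
    2 * σ 0 ≤ 2 * σ k + k := by
  have h1 := h 0 k (by omega) hk
  have e : max (k - 0) 2 = k := by
    rw [Nat.sub_zero, max_eq_left hk2]
  rw [e] at h1
  exact h1

/-- SCALING BOOKKEEPING: `Q_i · L^{σ_0} = L^{i + σ_i}`, i.e. the step-`(j+i)` cubes have side `L^{i}MR_{j+i}` in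
`L^{−j}`-units (*"by L^{n−j}MR_n-cubes in L^{−j}-scale"*). [cite: Balaban1989LargeFieldII, p.384 (definition of Z^{(n−j)})] -/
theorem Qprod_ratio_mul_pow {σ : ℕ → ℕ} {m : ℕ} (L : ℕ) (h : DropCtl σ m) :
    ∀ i, i ≤ m → Qprod (ratio L σ) i * L ^ σ 0 = L ^ (i + σ i)
  | 0 => fun _ => by simp
  | i + 1 => fun hi => by
      rw [Qprod_succ, mul_right_comm, Qprod_ratio_mul_pow L h i (by omega), ratio, ← pow_add]
      have := h.lag_one hi
      congr 1
      unfold qexp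
      omega

/-- `2^i ≤ Q_i` for `2 ≤ i ≤ m` and `L ≥ 4`: from `2(σ_0 − σ_i) ≤ i` one gets `Q_i² ≥ L^i ≥ 4^i` — the printed
`L^{−½(n−j)} ≤ 2^{−(n−j)}` without square roots (cf. `Step.Budget.sqrt_scaling_le_half_pow`, `L ≥ 4`). [cite: Balaban1989LargeFieldII, p.384 last display] -/
theorem two_pow_le_Qprod {σ : ℕ → ℕ} {m i L : ℕ} (hL : 4 ≤ L) (h : DropCtl σ m) (hi2 : 2 ≤ i) (hi : i ≤ m) :
    2 ^ i ≤ Qprod (ratio L σ) i := by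
  have hL0 : 0 < L := by omega
  have e := Qprod_ratio_mul_pow L h i hi
  have h0 := h.from_zero hi2 hi
  have key : 2 ^ i * L ^ σ 0 * (2 ^ i * L ^ σ 0) ≤
      Qprod (ratio L σ) i * L ^ σ 0 * (Qprod (ratio L σ) i * L ^ σ 0) := by
    rw [e, ← pow_add]
    calc 2 ^ i * L ^ σ 0 * (2 ^ i * L ^ σ 0) = (2 * 2) ^ i * L ^ (σ 0 + σ 0) := by
          rw [mul_pow, pow_add]; ring
      _ ≤ L ^ i * L ^ (σ 0 + σ 0) :=
          Nat.mul_le_mul_right _ (Nat.pow_le_pow_left (by omega) i)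
      _ = L ^ (i + (σ 0 + σ 0)) := by rw [← pow_add]
      _ ≤ L ^ (i + σ i + (i + σ i)) := Nat.pow_le_pow_right hL0 (by omega)
  have h2 : 2 ^ i * L ^ σ 0 ≤ Qprod (ratio L σ) i * L ^ σ 0 := Nat.mul_self_le_mul_self_iff.mp key
  exact Nat.le_of_mul_le_mul_right h2 (Nat.pow_pos hL0)

/-- THE RADIUS INVARIANT along the iteration of `S` on one cube: the radius (about the current coarse centre) is
`≤ 31` always, and `≤ 21` unless the last step was a no-gain step (`σ_{i−1} = σ_i + 1`). [cite: Balaban1989LargeFieldII, p.384 ("□₀^{~31}")] -/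
def RadInv (σ : ℕ → ℕ) (i r : ℕ) : Prop := r ≤ 31 ∧ (r ≤ 21 ∨ (1 ≤ i ∧ σ (i - 1) = σ i + 1))

/-- *"It is easy to see that S^{n−j}(□) is a cube … The MR_n-cube in the center of S^{n−j}(□) contains □ … □₀^{~31}"*,
KERNEL-CHECKED for every `L ≥ 3` under the drop control: `S^{i}({z}) ⊆ (coarse Q_i z)^{~r}` with `RadInv σ i r`.
Induction: a no-gain step (`q_i = 1`) finds `r ≤ 21` (two consecutive no-gain steps are excluded by `DropCtl.lag_two`)
and yields `r + 10 ≤ 31`; a gaining step (`q_i = L^{e} ≥ L ≥ 3`) yields `⌊r/q_i⌋ + 11 ≤ ⌊31/3⌋ + 11 = 21`. [cite: Balaban1989LargeFieldII, p.384 (display after (1.80))] -/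
theorem Siter_singleton_subset_box {L : ℕ} {σ : ℕ → ℕ} {m : ℕ} (hL : 3 ≤ L) (h : DropCtl σ m)
    (z : Pt d) : ∀ i, i ≤ m →
      ∃ r, RadInv σ i r ∧ Siter (ratio L σ) i {z} ⊆ box (coarse (Qprod (ratio L σ) i) z) r
  | 0 => fun _ => ⟨0, ⟨by norm_num, Or.inl (by norm_num)⟩, by
      rw [Siter_zero, Qprod_zero, coarse_one]
      exact Finset.singleton_subset_iff.mpr (mem_box_self z 0)⟩
  | i + 1 => fun hi => by
      obtain ⟨r, ⟨hr31, hflag⟩, hsub⟩ := Siter_singleton_subset_box hL h z i (by omega)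
      have hdn : σ i ≤ σ (i + 1) + 1 := h.lag_one hi
      have hL0 : 0 < L := by omega
      rw [Siter_succ, Qprod_succ, ← coarse_coarse]
      set c := coarse (Qprod (ratio L σ) i) z with hc
      have step : Sop (ratio L σ i) (Siter (ratio L σ) i {z}) ⊆
          box (coarse (ratio L σ i) c) (r / ratio L σ i + 11) :=
        (Sop_mono _ hsub).trans (Sop_box_subset (ratio_pos hL0 σ i) c r)
      rcases Nat.eq_zero_or_pos (qexp σ i) with he | he
      · -- no-gain step: the next partition is the same one (`ratio = 1`); ten layers are added at full size
        have hq1 : ratio L σ i = 1 := by simp [ratio, he]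
        have hσ : σ i = σ (i + 1) + 1 := by unfold qexp at he; omega
        have hr21 : r ≤ 21 := by
          rcases hflag with h21 | ⟨hi1, hσ'⟩
          · exact h21
          · exfalso
            have h2 := h.lag_two (i := i - 1) (by omega)
            rw [show i - 1 + 2 = i + 1 by omega] at h2
            omega
        refine ⟨r + 10, ⟨by omega, Or.inr ⟨by omega, by simpa using hσ⟩⟩, ?_⟩
        rw [hq1, coarse_one]
        exact (Sop_mono 1 hsub).trans (Sop_one_box_subset c r)
      · -- gaining step: `ratio = L^e ≥ L ≥ 3`, the radius contracts to at most 21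
        have hq : L ≤ ratio L σ i := by
          unfold ratio
          exact Nat.le_self_pow (by omega) L
        refine ⟨r / ratio L σ i + 11, ⟨?_, Or.inl ?_⟩, step⟩
        · have h1 : r / ratio L σ i ≤ r / L := Nat.div_le_div_left hq hL0
          have h2 : r / L < 11 := (Nat.div_lt_iff_lt_mul hL0).mpr (by omega)
          omega
        · have h1 : r / ratio L σ i ≤ r / L := Nat.div_le_div_left hq hL0
          have h2 : r / L < 11 := (Nat.div_lt_iff_lt_mul hL0).mpr (by omega)
          omega

/-- *"Thus S^{n−j}(Z) ⊂ ⋃_{□₀⊂Z^{(n−j)}} □₀^{~31}"* — KERNEL-CHECKED in the index model for every `L ≥ 3` under the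
drop control (`i = n − j ≤ m`). [cite: Balaban1989LargeFieldII, p.384 (display after (1.80))] -/
theorem Siter_subset_biUnion_box {L : ℕ} {σ : ℕ → ℕ} {m i : ℕ} (hL : 3 ≤ L) (h : DropCtl σ m)
    (Z : Finset (Pt d)) (hi : i ≤ m) :
    Siter (ratio L σ) i Z ⊆ (closureIdx (Qprod (ratio L σ) i) Z).biUnion fun c => box c 31 := by
  rw [Siter_eq_biUnion (ratio L σ) i Z, closureIdx, Finset.image_biUnion]
  refine Finset.biUnion_mono fun z _ => ?_
  obtain ⟨r, ⟨hr, -⟩, hsub⟩ := Siter_singleton_subset_box hL h z i hi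
  exact hsub.trans (box_mono _ hr)

/-- *"… and this implies d′_n(S^{n−j}(Z)) ≤ (63)^d (MR_n)^{−d} |Z^{(n−j)}|"* in cube-count form:
`|S^{i}(Z)| ≤ 63^d · |Z^{(i)}|`. [cite: Balaban1989LargeFieldII, p.384 (display after (1.80))] -/
theorem card_Siter_le {L : ℕ} {σ : ℕ → ℕ} {m i : ℕ} (hL : 3 ≤ L) (h : DropCtl σ m)
    (Z : Finset (Pt d)) (hi : i ≤ m) :
    (Siter (ratio L σ) i Z).card ≤ 63 ^ d * (closureIdx (Qprod (ratio L σ) i) Z).card := by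
  refine (Finset.card_le_card (Siter_subset_biUnion_box hL h Z hi)).trans
    (Finset.card_biUnion_le.trans ?_)
  simp only [card_box, Finset.sum_const, smul_eq_mul]
  rw [mul_comm]

/-! ## Part 5. The tree-length profile of the iterates (`h1`, `h2` of `Step.Budget.majorant_181`) -/

/-- One more coarsening does not increase the tree length of the cover (`q ≥ 1`; `TreeLength.mul_treeLen_closureIdx_le`).
[cite: Dimock2013, Lemma 10] -/
theorem treeLen_closureIdx_succ_le {L : ℕ} (hL : 0 < L) (σ : ℕ → ℕ) {Z : Finset (Pt d)} (hZ : Z.Nonempty)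
    (hZc : FaceConnected Z) (i : ℕ) :
    treeLen (closureIdx (Qprod (ratio L σ) (i + 1)) Z) ≤ treeLen (closureIdx (Qprod (ratio L σ) i) Z) := by
  rw [closureIdx_Qprod_succ]
  have h := mul_treeLen_closureIdx_le (ratio L σ i) (closureIdx_nonempty hZ)
    (faceConnected_closureIdx (Qprod_pos (ratio_pos hL σ) i) hZc)
  have h1 : (1 : ℝ) ≤ ratio L σ i := by exact_mod_cast ratio_pos hL σ i
  have h0 := treeLen_nonneg (closureIdx (ratio L σ i) (closureIdx (Qprod (ratio L σ) i) Z))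
  nlinarith

/-- `i ↦ d′_{j+i}(Z^{(i)})` is non-increasing. [cite: Dimock2013, Lemma 10] -/
theorem treeLen_closureIdx_antitone {L : ℕ} (hL : 0 < L) (σ : ℕ → ℕ) {Z : Finset (Pt d)} (hZ : Z.Nonempty)
    (hZc : FaceConnected Z) {i k : ℕ} (hik : i ≤ k) :
    treeLen (closureIdx (Qprod (ratio L σ) k) Z) ≤ treeLen (closureIdx (Qprod (ratio L σ) i) Z) := by
  induction k, hik using Nat.le_induction with
  | base => exact le_rfl
  | succ k _ ih => exact (treeLen_closureIdx_succ_le hL σ hZ hZc k).trans ih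

/-- THE SCALING PROPERTY as used: `2^i · d′_{j+i}(Z^{(i)}) ≤ d′_j(Z)` for `2 ≤ i ≤ m`, `L ≥ 4` (*"d′_n(Z^{(n−j)}) ≤
L^{−½(n−j)}d′_j(Z) ≤ 2^{−(n−j)}d′_j(Z) for n − j > 1"*; the exact coarsening `Q·d(closure) ≤ d` is
`TreeLength.mul_treeLen_closureIdx_le`, the print's "(6.31) [I]" being unresolvable). [cite: Balaban1989LargeFieldII, p.384 last display] -/
theorem two_pow_mul_treeLen_closureIdx_le {L : ℕ} {σ : ℕ → ℕ} {m i : ℕ} (hL : 4 ≤ L) (h : DropCtl σ m)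
    {Z : Finset (Pt d)} (hZ : Z.Nonempty) (hZc : FaceConnected Z) (hi2 : 2 ≤ i) (hi : i ≤ m) :
    (2 : ℝ) ^ i * treeLen (closureIdx (Qprod (ratio L σ) i) Z) ≤ treeLen Z := by
  have hsc := mul_treeLen_closureIdx_le (Qprod (ratio L σ) i) hZ hZc
  have hQ : ((2 ^ i : ℕ) : ℝ) ≤ ((Qprod (ratio L σ) i : ℕ) : ℝ) := by
    exact_mod_cast two_pow_le_Qprod hL h hi2 hi
  push_cast at hQ
  have h0 := treeLen_nonneg (closureIdx (Qprod (ratio L σ) i) Z)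
  exact (mul_le_mul_of_nonneg_right hQ h0).trans hsc

/-- The scaling property in the form consumed by `h1`, INCLUDING the first step: `½·t_i ≤ (½)^i·t_0` for
`1 ≤ i ≤ m`, `L ≥ 4` (`i = 1`: `t_1 ≤ t_0`, no gain claimed — the printed *"for n − j > 1"*). [cite: Balaban1989LargeFieldII, p.385 lines 1–3] -/
theorem half_pow_mul_treeLen_ge {L : ℕ} {σ : ℕ → ℕ} {m i : ℕ} (hL : 4 ≤ L) (h : DropCtl σ m)
    {Z : Finset (Pt d)} (hZ : Z.Nonempty) (hZc : FaceConnected Z) (hi1 : 1 ≤ i) (hi : i ≤ m) :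
    (1 / 2 : ℝ) * treeLen (closureIdx (Qprod (ratio L σ) i) Z) ≤ (1 / 2 : ℝ) ^ i * treeLen Z := by
  have hL0 : 0 < L := by omega
  have h0 := treeLen_nonneg (closureIdx (Qprod (ratio L σ) i) Z)
  rcases Nat.lt_or_ge i 2 with hlt | hge
  · have hi' : i = 1 := by omega
    subst hi'
    have h1 := treeLen_closureIdx_antitone hL0 σ hZ hZc (i := 0) (k := 1) (by omega)
    rw [Qprod_zero, closureIdx_one] at h1
    rw [pow_one]
    exact mul_le_mul_of_nonneg_left h1 (by norm_num)
  · have h2 := two_pow_mul_treeLen_closureIdx_le hL h hZ hZc hge hi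
    have e1 : (1 / 2 : ℝ) ^ i * 2 ^ i = 1 := by rw [← mul_pow]; norm_num
    calc (1 / 2 : ℝ) * treeLen (closureIdx (Qprod (ratio L σ) i) Z)
        ≤ 1 * treeLen (closureIdx (Qprod (ratio L σ) i) Z) := mul_le_mul_of_nonneg_right (by norm_num) h0
      _ = (1 / 2 : ℝ) ^ i * (2 ^ i * treeLen (closureIdx (Qprod (ratio L σ) i) Z)) := by
          rw [← mul_assoc, e1]
      _ ≤ (1 / 2 : ℝ) ^ i * treeLen Z := mul_le_mul_of_nonneg_left h2 (by positivity)

/-- `d′_{j+i}(S^{i}(Z)) ≤ 63^d · 2^d(4·d′_{j+i}(Z^{(i)}) + 1) − 1` (`L ≥ 3`, `i ≤ m`): tree length ≤ cube count − 1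
(`TreeLength.treeLen_le_card_sub_one`), `card_Siter_le`, and the REPAIRED lower (2.30) `TreeLength.card_le_treeLen`
in place of the printed `3·2^{d−1}d′` / `(64)^d`. [cite: Balaban1989LargeFieldII, p.384 (display after (1.80))] -/
theorem treeLen_Siter_le {L : ℕ} {σ : ℕ → ℕ} {m i : ℕ} (hL : 3 ≤ L) (h : DropCtl σ m)
    {Z : Finset (Pt d)} (hZ : Z.Nonempty) (hZc : FaceConnected Z) (hi : i ≤ m) :
    treeLen (Siter (ratio L σ) i Z) ≤
      63 ^ d * (2 ^ d * (4 * treeLen (closureIdx (Qprod (ratio L σ) i) Z) + 1)) - 1 := by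
  have hL0 : 0 < L := by omega
  have hne := Siter_nonempty (ratio L σ) hZ i
  have hfc := faceConnected_Siter (ratio_pos hL0 σ) hZc i
  have h1 := treeLen_le_card_sub_one hne hfc
  have h2 : ((Siter (ratio L σ) i Z).card : ℝ) ≤ 63 ^ d * ((closureIdx (Qprod (ratio L σ) i) Z).card : ℝ) := by
    exact_mod_cast card_Siter_le hL h Z hi
  have h3 := card_le_treeLen (closureIdx_nonempty hZ)
    (faceConnected_closureIdx (Qprod_pos (ratio_pos hL0 σ) i) hZc)
  have h63 : (0 : ℝ) ≤ 63 ^ d := by positivity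
  nlinarith [mul_le_mul_of_nonneg_left h3 h63]

/-- BINDER `h1` OF `Step.Budget.majorant_181`, DISCHARGED: while `d′_{j+i}(Z^{(i)}) ≥ 1` (`1 ≤ i ≤ m`, `L ≥ 4`),
`d′_{j+i}(S^{i}(Z)) ≤ 10·126^d · (½)^i · d′_j(Z)` — the printed `3(126)^d 2^{−(n−j)} d′_j(Z)` with the repaired constant.
[cite: Balaban1989LargeFieldII, (1.81) p.385] -/
theorem profile_h1 {L : ℕ} {σ : ℕ → ℕ} {m i : ℕ} (hL : 4 ≤ L) (h : DropCtl σ m)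
    {Z : Finset (Pt d)} (hZ : Z.Nonempty) (hZc : FaceConnected Z) (hi1 : 1 ≤ i) (hi : i ≤ m)
    (ht : 1 ≤ treeLen (closureIdx (Qprod (ratio L σ) i) Z)) :
    treeLen (Siter (ratio L σ) i Z) ≤ 10 * 126 ^ d * (1 / 2 : ℝ) ^ i * treeLen Z := by
  set t := treeLen (closureIdx (Qprod (ratio L σ) i) Z) with ht_def
  have hs := treeLen_Siter_le (show 3 ≤ L by omega) h hZ hZc hi
  have hhalf := half_pow_mul_treeLen_ge hL h hZ hZc hi1 hi
  rw [← ht_def] at hs hhalf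
  have h126 : (63 : ℝ) ^ d * 2 ^ d = 126 ^ d := by rw [← mul_pow]; norm_num
  have hp : (0 : ℝ) ≤ 126 ^ d := by positivity
  have hs' : treeLen (Siter (ratio L σ) i Z) ≤ 5 * 126 ^ d * t := by
    have e : (63 : ℝ) ^ d * (2 ^ d * (4 * t + 1)) - 1 = 126 ^ d * (4 * t + 1) - 1 := by
      rw [← h126]; ring
    rw [e] at hs
    nlinarith [mul_le_mul_of_nonneg_left ht hp]
  calc treeLen (Siter (ratio L σ) i Z) ≤ 5 * 126 ^ d * t := hs'
    _ = 10 * 126 ^ d * ((1 / 2 : ℝ) * t) := by ring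
    _ ≤ 10 * 126 ^ d * ((1 / 2 : ℝ) ^ i * treeLen Z) := mul_le_mul_of_nonneg_left hhalf (by positivity)
    _ = 10 * 126 ^ d * (1 / 2 : ℝ) ^ i * treeLen Z := by ring

/-- BINDER `h2` OF `Step.Budget.majorant_181`, DISCHARGED: once `d′_{j+i}(Z^{(i)}) < 1` (`i ≤ m`, `L ≥ 3`),
`d′_{j+i}(S^{i}(Z)) ≤ 5·126^d` — the printed `(64)^d` with the repaired constant (*"S^{n₀+1−j}(Z) is contained in a
cube of the size 64MR_{n₀+1}"*). [cite: Balaban1989LargeFieldII, (1.81) p.385] -/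
theorem profile_h2 {L : ℕ} {σ : ℕ → ℕ} {m i : ℕ} (hL : 3 ≤ L) (h : DropCtl σ m)
    {Z : Finset (Pt d)} (hZ : Z.Nonempty) (hZc : FaceConnected Z) (hi : i ≤ m)
    (ht : treeLen (closureIdx (Qprod (ratio L σ) i) Z) < 1) :
    treeLen (Siter (ratio L σ) i Z) ≤ 5 * 126 ^ d := by
  set t := treeLen (closureIdx (Qprod (ratio L σ) i) Z) with ht_def
  have hs := treeLen_Siter_le hL h hZ hZc hi
  rw [← ht_def] at hs
  have h126 : (63 : ℝ) ^ d * 2 ^ d = 126 ^ d := by rw [← mul_pow]; norm_num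
  have e : (63 : ℝ) ^ d * (2 ^ d * (4 * t + 1)) - 1 = 126 ^ d * (4 * t + 1) - 1 := by
    rw [← h126]; ring
  rw [e] at hs
  have hp : (0 : ℝ) ≤ 126 ^ d := by positivity
  have h4 : 4 * t + 1 ≤ 5 := by linarith
  nlinarith [mul_le_mul_of_nonneg_left h4 hp]

/-! ## Part 6. *"Let n₀ be the last index n such that d′_n(Z^{(n−j)}) > 0"* -/

/-- For a non-increasing real sequence on `[0, m]` there is a last index `i₀ ≤ m` with `t_i ≥ 1` exactly for
`1 ≤ i ≤ i₀` (among `i ≥ 1`) and `t_i < 1` for `i₀ < i ≤ m`. [folklore] -/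
theorem exists_lastIndex : ∀ (m : ℕ) (t : ℕ → ℝ), (∀ i k, i ≤ k → k ≤ m → t k ≤ t i) →
    ∃ i₀, i₀ ≤ m ∧ (∀ i, 1 ≤ i → i ≤ i₀ → 1 ≤ t i) ∧ (∀ i, i₀ < i → i ≤ m → t i < 1)
  | 0, t, _ => ⟨0, le_rfl, fun i h1 h0 => by omega, fun i h1 h0 => by omega⟩
  | m + 1, t, hanti => by
      by_cases hlast : 1 ≤ t (m + 1)
      · exact ⟨m + 1, le_rfl, fun i _ hi => le_trans hlast (hanti i (m + 1) hi le_rfl),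
          fun i h1 h2 => by omega⟩
      · obtain ⟨i₀, hi₀, hA, hB⟩ := exists_lastIndex m t (fun i k hik hk => hanti i k hik (by omega))
        refine ⟨i₀, by omega, hA, fun i h1 h2 => ?_⟩
        rcases Nat.lt_or_ge i (m + 1) with hlt | hge
        · exact hB i h1 (by omega)
        · have hi : i = m + 1 := by omega
          rw [hi]
          exact not_le.mp hlast

/-- THE INDEX `n₀ = j + i₀` of p. 385 (typed with the threshold `d′ ≥ 1` / `d′ < 1`): the tree lengths of the covers
`Z^{(i)}` are `≥ 1` up to `i₀` and `< 1` after, on the horizon `[0, m]`. [cite: Balaban1989LargeFieldII, p.385 (definition of n₀)] -/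
theorem exists_threshold {L : ℕ} (hL : 0 < L) (σ : ℕ → ℕ) (m : ℕ) {Z : Finset (Pt d)} (hZ : Z.Nonempty)
    (hZc : FaceConnected Z) :
    ∃ i₀, i₀ ≤ m ∧ (∀ i, 1 ≤ i → i ≤ i₀ → 1 ≤ treeLen (closureIdx (Qprod (ratio L σ) i) Z)) ∧
      (∀ i, i₀ < i → i ≤ m → treeLen (closureIdx (Qprod (ratio L σ) i) Z) < 1) :=
  exists_lastIndex m _ fun _ _ hik _ => treeLen_closureIdx_antitone hL σ hZ hZc hik

/-! ## Part 7. (1.81), second to third expression, WITH the profile bounds supplied -/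

/-- The drop control on the absolute horizon `[0, K]` restricts to the relative horizon `[j, K]` (re-indexed). [folklore] -/
theorem dropCtl_shift {σ : ℕ → ℕ} {K j : ℕ}
    (hdrop : ∀ m n, m < n → n ≤ K → 2 * σ m ≤ 2 * σ n + max (n - m) 2) :
    DropCtl (fun i => σ (j + i)) (K - j) := by
  intro i k hik hk
  have h := hdrop (j + i) (j + k) (by omega) (by omega)
  rw [show j + k - (j + i) = k - i by omega] at h
  exact h

/-- (1.81), SECOND TO THIRD EXPRESSION, with the geometric profile bounds DISCHARGED (= `Step.Budget.majorant_181_of_rStepLe`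
with `h1 := profile_h1`, `h2 := profile_h2`): for sizes `R_n = L^{σ_n}` on `[0, K]` ((2.5)) obeying (2.9)'s first
member (`RStepLe`) and the two-sided drop control, `L ≥ 4`, a non-empty face-connected `Z`, and the threshold index
`n₀` (`d′_n(Z^{(n−j)}) ≥ 1` on `(j, n₀]`, `< 1` on `(n₀, n₀+r]`, `n₀ + r ≤ K`):
`Σ_{n=j+1}^{n₀+r} cost_n(d′_n(S^{n−j}(Z))) ≤ C·M^{d_b}·(L^{d_b+1}R_j^{d_b+1})·(10·126^d·d′_j(Z) + 5·126^d·r)`.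
The stopping rule `r ≤ R_j` (conditions (i), (ii) of p. 383) is NOT supplied. [cite: Balaban1989LargeFieldII, (1.81) p.385] -/
theorem majorant_181_of_flow (b : Step.Budget.Consts) (L : ℕ) (hL : 4 ≤ L) (K j n₀ r : ℕ)
    (hj : j ≤ n₀) (hK : n₀ + r ≤ K) (σ : ℕ → ℕ) (hRpow : ∀ n, n ≤ K → b.R n = (L : ℝ) ^ σ n)
    (h29a : Step.Budget.RStepLe b.R L K)
    (hdrop : ∀ m n, m < n → n ≤ K → 2 * σ m ≤ 2 * σ n + max (n - m) 2)
    (hC : 0 ≤ b.C) (hM : 0 ≤ b.M) (Z : Finset (Pt d)) (hZ : Z.Nonempty) (hZc : FaceConnected Z)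
    (hn₀ : ∀ n ∈ Finset.Ioc j n₀,
      1 ≤ treeLen (closureIdx (Qprod (ratio L (fun i => σ (j + i))) (n - j)) Z))
    (hn₀' : ∀ n ∈ Finset.Ioc n₀ (n₀ + r),
      treeLen (closureIdx (Qprod (ratio L (fun i => σ (j + i))) (n - j)) Z) < 1) :
    ∑ n ∈ Finset.Ioc j (n₀ + r), b.cost n (treeLen (Siter (ratio L (fun i => σ (j + i))) (n - j) Z)) ≤
      b.C * b.M ^ b.d * ((L : ℝ) ^ (b.d + 1) * b.R j ^ (b.d + 1)) *
        (10 * 126 ^ d * treeLen Z + 5 * 126 ^ d * r) := by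
  have hD : DropCtl (fun i => σ (j + i)) (K - j) := dropCtl_shift hdrop
  refine Step.Budget.majorant_181_of_rStepLe b L K j n₀ r hj hK (10 * 126 ^ d) (5 * 126 ^ d) (treeLen Z)
    (fun n => treeLen (Siter (ratio L (fun i => σ (j + i))) (n - j) Z)) hC hM (by positivity)
    (treeLen_nonneg Z) (by positivity) (by positivity) h29a ?_ ?_ ?_
  · intro n hn
    rw [hRpow n hn]
    positivity
  · intro n hn
    have hn' := Finset.mem_Ioc.mp hn
    exact profile_h1 hL hD hZ hZc (by omega) (by omega) (hn₀ n hn)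
  · intro n hn
    have hn' := Finset.mem_Ioc.mp hn
    exact profile_h2 (show 3 ≤ L by omega) hD hZ hZc (by omega) (hn₀' n hn)

/-! ## Part 8. The flow inputs from [III]: (2.5), (2.7), (2.9), and the end-to-end statement -/

/-- (2.5) on the horizon gives exponents: `R_n = L^{σ_n}`, `(log g_n⁻²)^p ≤ R_n`, and `σ_n` is minimal (`n ≤ K`).
[cite: Balaban1988Convergent, (2.5) p.255] -/
theorem exists_exponents {L p K : ℕ} {g : ℕ → ℝ} (R : ℕ → ℕ)
    (hR : ∀ n, n ≤ K → B14.IsRj L p (g n) (R n)) :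
    ∃ σ : ℕ → ℕ, ∀ n, n ≤ K → R n = L ^ σ n ∧ (Real.log ((g n) ^ 2)⁻¹) ^ p ≤ (R n : ℝ) ∧
      ∀ s' : ℕ, (Real.log ((g n) ^ 2)⁻¹) ^ p ≤ ((L ^ s' : ℕ) : ℝ) → σ n ≤ s' := by
  classical
  refine ⟨fun n => if h : n ≤ K then Classical.choose (hR n h) else 0, fun n hn => ?_⟩
  simp only [dif_pos hn]
  exact Classical.choose_spec (hR n hn)

/-- ONE PAIR, exponent form of the rounding mechanism of `B14FlowStep.ineq29a_pair`: if `(log g_m⁻²)^p ≤ Θ (log g_n⁻²)^p`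
((2.7), second member) with `Θ ≤ L^a`, `(log g_n⁻²)^p ≥ 0`, `R_n = L^{s_n} ≥ (log g_n⁻²)^p` and `s_m` minimal ((2.5)),
then `s_m ≤ s_n + a` (`R_m ≤ L^a R_n`). [cite: Balaban1988Convergent, (2.9) p.256] -/
theorem exp_drop_le {L p : ℕ} (hL : 1 ≤ L) {gm gn Θ : ℝ} {a sm sn Rn : ℕ}
    (hΘ : Θ ≤ (L : ℝ) ^ a) (hPn0 : 0 ≤ (Real.log (gn ^ 2)⁻¹) ^ p)
    (hRn : Rn = L ^ sn) (hlen : (Real.log (gn ^ 2)⁻¹) ^ p ≤ (Rn : ℝ))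
    (hminm : ∀ s' : ℕ, (Real.log (gm ^ 2)⁻¹) ^ p ≤ ((L ^ s' : ℕ) : ℝ) → sm ≤ s')
    (h27b : (Real.log (gm ^ 2)⁻¹) ^ p ≤ Θ * (Real.log (gn ^ 2)⁻¹) ^ p) :
    sm ≤ sn + a := by
  have hL0 : (0 : ℝ) ≤ (L : ℝ) ^ a := by positivity
  have h1 : (Real.log (gm ^ 2)⁻¹) ^ p ≤ ((L ^ (sn + a) : ℕ) : ℝ) := by
    calc (Real.log (gm ^ 2)⁻¹) ^ p ≤ Θ * (Real.log (gn ^ 2)⁻¹) ^ p := h27b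
      _ ≤ (L : ℝ) ^ a * (Real.log (gn ^ 2)⁻¹) ^ p := mul_le_mul_of_nonneg_right hΘ hPn0
      _ ≤ (L : ℝ) ^ a * (Rn : ℝ) := mul_le_mul_of_nonneg_left hlen hL0
      _ = ((L ^ (sn + a) : ℕ) : ℝ) := by rw [hRn]; push_cast; ring
  exact hminm (sn + a) h1

/-- THE DROP CONTROL FROM THE FLOW: inside the interval (`Step.InInterval γ K g`, `γ ≤ 1`), (2.5) with its minimality,
(2.7)'s second member and the located smallness `(1 + g_n²β′(n−m))^{β₀} ≤ L^{⌊max(n−m,2)/2⌋}` for all pairs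
`m < n ≤ K` give `2σ_m ≤ 2σ_n + max(n−m, 2)`. [cite: Balaban1988Convergent, (2.7)–(2.9) pp.255–256] -/
theorem dropCtl_of_27b {L p K : ℕ} (hL : 1 ≤ L) {g : ℕ → ℝ} {γ β' β₀ : ℝ} (hI : Step.InInterval γ K g)
    (hγ1 : γ ≤ 1) (R : ℕ → ℕ) (σ : ℕ → ℕ)
    (hσ : ∀ n, n ≤ K → R n = L ^ σ n ∧ (Real.log ((g n) ^ 2)⁻¹) ^ p ≤ (R n : ℝ) ∧
      ∀ s' : ℕ, (Real.log ((g n) ^ 2)⁻¹) ^ p ≤ ((L ^ s' : ℕ) : ℝ) → σ n ≤ s')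
    (h27 : B14.FlowIneq27 g β' β₀ p K)
    (hΘ : ∀ m n, m < n → n ≤ K →
      (1 + (g n) ^ 2 * β' * ((n : ℝ) - m)) ^ β₀ ≤ (L : ℝ) ^ (max (n - m) 2 / 2)) :
    ∀ m n, m < n → n ≤ K → 2 * σ m ≤ 2 * σ n + max (n - m) 2 := by
  intro m n hmn hnK
  obtain ⟨-, h27b⟩ := h27 m n hmn hnK
  have hn := hI n hnK
  have hPn0 : 0 ≤ (Real.log ((g n) ^ 2)⁻¹) ^ p :=
    pow_nonneg (B14FlowStep.log_inv_sq_nonneg hn.1 (le_trans hn.2 hγ1)) p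
  obtain ⟨hRn, hlen, -⟩ := hσ n hnK
  obtain ⟨-, -, hminm⟩ := hσ m (le_trans hmn.le hnK)
  have h := exp_drop_le hL (hΘ m n hmn hnK) hPn0 hRn hlen hminm h27b
  have h2 : 2 * (max (n - m) 2 / 2) ≤ max (n - m) 2 := Nat.mul_div_le _ _
  omega

/-- `2k + 2 ≤ 4^k` for `k ≥ 1`. [folklore] -/
theorem two_mul_add_two_le_four_pow : ∀ k : ℕ, 1 ≤ k → 2 * k + 2 ≤ 4 ^ k := by
  intro k hk
  induction k, hk using Nat.le_induction with
  | base => norm_num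
  | succ k _ ih => rw [pow_succ]; omega

/-- `ℓ + 1 ≤ 2^{2⌊max(ℓ,2)/2⌋}` for every `ℓ`. [folklore] -/
theorem succ_le_pow_two_mul_half (ℓ : ℕ) : ℓ + 1 ≤ 2 ^ (2 * (max ℓ 2 / 2)) := by
  set k := max ℓ 2 / 2 with hk
  have hk1 : 1 ≤ k := by
    have : 2 ≤ max ℓ 2 := le_max_right _ _
    omega
  have hℓ : ℓ ≤ 2 * k + 1 := by
    have h1 : max ℓ 2 < 2 * (k + 1) := by
      have := Nat.lt_div_mul_add (show 0 < 2 by norm_num) (a := max ℓ 2)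
      omega
    have h2 : ℓ ≤ max ℓ 2 := le_max_left _ _
    omega
  calc ℓ + 1 ≤ 2 * k + 2 := by omega
    _ ≤ 4 ^ k := two_mul_add_two_le_four_pow k hk1
    _ = 2 ^ (2 * k) := by rw [pow_mul]; norm_num

/-- THE LOCATED SMALLNESS IS INHABITED FOR EVERY LAG: if `β₀ ≤ ½`, `0 ≤ X ≤ ℓ` (e.g. `X = g_n²β′(n−m)` with
`g_n²β′ ≤ 1`, `ℓ = n − m`) and `L ≥ 2`, then `(1 + X)^{β₀} ≤ L^{⌊max(ℓ,2)/2⌋}`.  (By contrast the UNIFORM bound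
`(1 + g_n²β′(n−m))^{β₀} ≤ L` — i.e. `R_m ≤ L R_n` for all lags — fails on long horizons; (2.9)'s third member carries
the factor `(n−m)^{β₀}`.) [cite: Balaban1988Convergent, (2.9) p.256] -/
theorem theta_le_pow {β₀ X : ℝ} {L ℓ : ℕ} (hβ : β₀ ≤ 1 / 2) (hX0 : 0 ≤ X) (hX : X ≤ ℓ)
    (hL : 2 ≤ L) : (1 + X) ^ β₀ ≤ (L : ℝ) ^ (max ℓ 2 / 2) := by
  set a := max ℓ 2 / 2 with ha
  have h1X : (1 : ℝ) ≤ 1 + X := by linarith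
  have hL2 : (2 : ℝ) ≤ L := by exact_mod_cast hL
  have step1 : (1 + X) ^ β₀ ≤ (1 + X) ^ (1 / 2 : ℝ) := Real.rpow_le_rpow_of_exponent_le h1X hβ
  have hsq : (1 + X) ≤ ((2 : ℝ) ^ a) ^ 2 := by
    have hnat : ((ℓ + 1 : ℕ) : ℝ) ≤ ((2 ^ (2 * a) : ℕ) : ℝ) := by
      exact_mod_cast succ_le_pow_two_mul_half ℓ
    push_cast at hnat
    rw [← pow_mul, mul_comm]
    linarith
  have step2 : (1 + X) ^ (1 / 2 : ℝ) ≤ (2 : ℝ) ^ a := by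
    rw [← Real.sqrt_eq_rpow]
    exact Real.sqrt_le_iff.mpr ⟨by positivity, hsq⟩
  have step3 : (2 : ℝ) ^ a ≤ (L : ℝ) ^ a := pow_le_pow_left₀ (by norm_num) hL2 a
  exact step1.trans (step2.trans step3)

/-- END TO END — (1.81), second to third expression, FROM THE FLOW DISPLAYS OF [III]: given the running couplings in
the interval on `[0, K]` (`Step.InInterval γ K g`, `γ ≤ 1`), sizes `R_n` satisfying (2.5) (`B14.IsRj L p (g n) (R n)`,
`n ≤ K`) and equal to the cost constants' `b.R n`, (2.9)'s first member, (2.7) (`B14.FlowIneq27`), the located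
smallness `(1 + g_n²β′(n−m))^{β₀} ≤ L^{⌊max(n−m,2)/2⌋}` (a theorem for `β₀ ≤ ½`, `g_n²β′ ≤ 1`: `theta_le_pow`),
`L ≥ 4`, and a non-empty face-connected `Z` at step `j ≤ K`: there are exponents `σ` (`R_n = L^{σ_n}`) and the index
`n₀ ∈ [j, K]` with `d′_n(Z^{(n−j)}) ≥ 1` on `(j, n₀]` and `< 1` on `(n₀, K]`, such that for every `r ≤ K − n₀`
`Σ_{n=j+1}^{n₀+r} cost_n(d′_n(S^{n−j}(Z))) ≤ C·M^{d_b}·(L^{d_b+1}R_j^{d_b+1})·(10·126^d·d′_j(Z) + 5·126^d·r)`.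
NOT supplied: the stopping rule `r ≤ R_j`. [cite: Balaban1989LargeFieldII, (1.81) p.385] -/
theorem majorant_181_of_B14 (b : Step.Budget.Consts) {L p K : ℕ} (hL : 4 ≤ L) {g : ℕ → ℝ}
    {γ β' β₀ : ℝ} (hI : Step.InInterval γ K g) (hγ1 : γ ≤ 1) (R : ℕ → ℕ)
    (hR : ∀ n, n ≤ K → B14.IsRj L p (g n) (R n)) (hbR : ∀ n, n ≤ K → b.R n = (R n : ℝ))
    (h29a : ∀ m n, m < n → n ≤ K → (R n : ℝ) ≤ L * R m) (h27 : B14.FlowIneq27 g β' β₀ p K)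
    (hΘ : ∀ m n, m < n → n ≤ K →
      (1 + (g n) ^ 2 * β' * ((n : ℝ) - m)) ^ β₀ ≤ (L : ℝ) ^ (max (n - m) 2 / 2))
    (hC : 0 ≤ b.C) (hM : 0 ≤ b.M) (Z : Finset (Pt d)) (hZ : Z.Nonempty) (hZc : FaceConnected Z)
    (j : ℕ) (hjK : j ≤ K) :
    ∃ (σ : ℕ → ℕ) (n₀ : ℕ), (∀ n, n ≤ K → R n = L ^ σ n) ∧ j ≤ n₀ ∧ n₀ ≤ K ∧
      (∀ n ∈ Finset.Ioc j n₀,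
        1 ≤ treeLen (closureIdx (Qprod (ratio L (fun i => σ (j + i))) (n - j)) Z)) ∧
      (∀ n ∈ Finset.Ioc n₀ K,
        treeLen (closureIdx (Qprod (ratio L (fun i => σ (j + i))) (n - j)) Z) < 1) ∧
      ∀ r, n₀ + r ≤ K →
        ∑ n ∈ Finset.Ioc j (n₀ + r), b.cost n (treeLen (Siter (ratio L (fun i => σ (j + i))) (n - j) Z)) ≤
          b.C * b.M ^ b.d * ((L : ℝ) ^ (b.d + 1) * b.R j ^ (b.d + 1)) *
            (10 * 126 ^ d * treeLen Z + 5 * 126 ^ d * r) := by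
  have hL0 : 0 < L := by omega
  obtain ⟨σ, hσ⟩ := exists_exponents R hR
  obtain ⟨i₀, hi₀, hA, hB⟩ := exists_threshold hL0 (fun i => σ (j + i)) (K - j) hZ hZc
  have hRpow : ∀ n, n ≤ K → b.R n = (L : ℝ) ^ σ n := by
    intro n hn
    rw [hbR n hn, (hσ n hn).1]
    push_cast
    rfl
  have h29 : Step.Budget.RStepLe b.R L K := by
    intro m n hmn hnK
    rw [hbR n hnK, hbR m (le_trans hmn.le hnK)]
    exact h29a m n hmn hnK
  have hdrop := dropCtl_of_27b (by omega) hI hγ1 R σ hσ h27 hΘ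
  refine ⟨σ, j + i₀, fun n hn => (hσ n hn).1, by omega, by omega, ?_, ?_, ?_⟩
  · intro n hn
    have hn' := Finset.mem_Ioc.mp hn
    exact hA (n - j) (by omega) (by omega)
  · intro n hn
    have hn' := Finset.mem_Ioc.mp hn
    exact hB (n - j) (by omega) (by omega)
  · intro r hr
    refine majorant_181_of_flow b L hL K j (j + i₀) r (by omega) hr σ hRpow h29 hdrop hC hM Z hZ hZc ?_ ?_
    · intro n hn
      have hn' := Finset.mem_Ioc.mp hn
      exact hA (n - j) (by omega) (by omega)
    · intro n hn
      have hn' := Finset.mem_Ioc.mp hn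
      exact hB (n - j) (by omega) (by omega)

end

end Literature.MathematicalPhysics.QuantumFieldTheory.Balaban1983to89.B16SProfile
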